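import Literature.NumberTheory.Automorphic.UnitaryGroupIsotropicFrameChart
import HarnessLib

/-!
# The parabolic of an isotropic line in the adapted symplectic chart: root elements, Levi dilations, the two lines

Topic `NumberTheory/Automorphic`; namespace `Literature.NumberTheory.Automorphic.UnitaryGroup.IsQuadraticCoordinates`
(sequel of `UnitaryGroupIsotropicFrameChart`; the elements are the tree's `lineRoot` / `lineDilation` of
`UnitaryGroupIsotropicLineElements`).  KERNEL ONLY: theorems, no definition, no named fact, no `sorry`.

With the data of `exists_frameChart` (quadratic coordinates `h`, `σ`, symmetric `T`, hyperbolic frame `(x₀, y₀, b, a)` of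
`B = hermForm σ (T ⊗ 1)`) and any map `Γv` on `Sⁿ` given by the chart formula
`Γv v = ((re B(x₀,v), im B(x₀,v)) ⊔ (aⱼ⁻¹ re B(bⱼ,v)) ; (im B(y₀,v), -re B(y₀,v)) ⊔ (im B(bⱼ,v)))` we compute `Γv` on:

* the two lines: `Γv (μ • x₀) = (0 ; (im μ, -re μ) ⊔ 0)` (the MODULATION directions of the chart) and
  `Γv (λ • y₀) = ((re λ, im λ) ⊔ 0 ; 0)` (the TRANSLATION directions) — `frameCoords_smul_left`, `frameCoords_smul_partner`;
* the TRANSVECTIONS `n_t = T_{x₀}(0, φ(t) δ)` (`lineRoot`): only the first two modulation coordinates move,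
  `y ↦ y + (t x₀, -t d x₁)` — a unipotent element of the Siegel parabolic of the chart whose quadratic form is
  `½ t (x₀² - d x₁²) = ½ t N_{S/R}` on the translation coordinates of the line (`frameCoords_lineRoot_zero`);
* the LEVI DILATIONS `D(α, β)` (`lineDilation`): the `2 × 2` blocks `Res(β)` on the translation and `Res(α)`-dual on the
  modulation coordinates of the line, identity elsewhere (`frameCoords_lineDilation`);
* the EICHLER ELEMENTS `T_{x₀}(w, τ)`, `w = Σ γⱼ bⱼ`, `τ` real (`frameCoords_lineRoot_sum`): a shear of the `Fin m`
  translation coordinates by `re(λ γⱼ)` (`λ = x₀ + x₁ δ` the line coordinate) — the Levi part — and modulations linear in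
  the other coordinates — the unipotent part; on the fibre over `λ ≠ 0` they realise every Heisenberg translation and
  modulation of `R^m`.

[MoeglinVignerasWaldspurger1987, Chap. 3 §IV.2]: in the mixed model attached to `X' = S x₀` the parabolic of the line acts
through the Siegel parabolic of `Sp`; these are its matrix entries.  Written for the cell `hodgecm-mathlib` (fan B, rung B-IV).

## References
* [MoeglinVignerasWaldspurger1987] C. Mœglin, M.-F. Vignéras, J.-L. Waldspurger, LNM 1291 (1987), Chap. 3 §IV.2.
* [Dieudonne1971GroupesClassiques] J. Dieudonné, *La géométrie des groupes classiques* (1971), Chap. II §5.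
-/

set_option autoImplicit false

namespace Literature.NumberTheory.Automorphic

namespace UnitaryGroup

namespace IsQuadraticCoordinates

open _root_.Matrix QuadraticCoordinates Literature.RepresentationTheory.HeisenbergGroup

section Action

variable {R S : Type*} [Field R] [CommRing S]
variable {φ : R →+* S} {Ψ : (R × R) ≃+ S} {δ : S} {d : R} (h : IsQuadraticCoordinates φ Ψ δ d)
variable {n : Type*} [Fintype n] [DecidableEq n]
variable {T : Matrix n n R} {σ : S →+* S} {m : ℕ} {x₀ y₀ : n → S} {b : Fin m → n → S} {a : Fin m → R}
variable (Γv : (n → S) → ((Fin 2 ⊕ Fin m) → R) × ((Fin 2 ⊕ Fin m) → R))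
variable (hΓ : ∀ v : n → S, Γv v =
  (Sum.elim ![re Ψ (hermForm σ (T.map φ) x₀ v), im Ψ (hermForm σ (T.map φ) x₀ v)]
      (fun j => (a j)⁻¹ * re Ψ (hermForm σ (T.map φ) (b j) v)),
    Sum.elim ![im Ψ (hermForm σ (T.map φ) y₀ v), -re Ψ (hermForm σ (T.map φ) y₀ v)]
      (fun j => im Ψ (hermForm σ (T.map φ) (b j) v))))
include h hΓ

omit h [DecidableEq n] in
include hΓ in
/-- **the isotropic line in the chart**: `Γv (μ • x₀) = (0 ; (im μ, -re μ) ⊔ 0)` — the line `S x₀` is the plane of the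
first two MODULATION coordinates. [cite: MoeglinVignerasWaldspurger1987, Chap. 3 §IV.2] -/
theorem frameCoords_smul_left (hx : hermForm σ (T.map φ) x₀ x₀ = 0) (hyx : hermForm σ (T.map φ) y₀ x₀ = 1)
    (hbx : ∀ j, hermForm σ (T.map φ) (b j) x₀ = 0) (μ : S) :
    Γv (μ • x₀) = (0, Sum.elim ![im Ψ μ, -re Ψ μ] 0) := by
  rw [hΓ]
  simp only [hermForm_smul_right, hx, hyx, hbx, mul_zero, mul_one, map_zero]
  refine Prod.ext (funext fun i => ?_) (funext fun i => ?_)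
  · rcases i with i | j
    · fin_cases i <;> rfl
    · simp
  · rcases i with i | j
    · fin_cases i <;> rfl
    · rfl

omit h [DecidableEq n] in
include hΓ in
/-- **the hyperbolic partner line in the chart**: `Γv (λ • y₀) = ((re λ, im λ) ⊔ 0 ; 0)` — the line `S y₀` is the plane of
the first two TRANSLATION coordinates. [cite: MoeglinVignerasWaldspurger1987, Chap. 3 §IV.2] -/
theorem frameCoords_smul_partner (hy : hermForm σ (T.map φ) y₀ y₀ = 0) (hxy : hermForm σ (T.map φ) x₀ y₀ = 1)
    (hby : ∀ j, hermForm σ (T.map φ) (b j) y₀ = 0) (lam : S) :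
    Γv (lam • y₀) = (Sum.elim ![re Ψ lam, im Ψ lam] 0, 0) := by
  rw [hΓ]
  simp only [hermForm_smul_right, hy, hxy, hby, mul_zero, mul_one, map_zero, neg_zero]
  refine Prod.ext (funext fun i => ?_) (funext fun i => ?_)
  · rcases i with i | j
    · fin_cases i <;> rfl
    · simp
  · rcases i with i | j
    · fin_cases i <;> rfl
    · rfl

/-- **the transvections of the line in the chart**: `n_t = T_{x₀}(0, φ(t) δ)` fixes all translation coordinates and
the `Fin m` modulation coordinates and shifts the modulation coordinates of the line by `(t x₀, -t d x₁)`, `(x₀, x₁)` the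
translation coordinates of the line: a unipotent element of the Siegel parabolic of the chart with quadratic form
`½ t (x₀² - d x₁²)`. [cite: MoeglinVignerasWaldspurger1987, Chap. 3 §IV.2] -/
theorem frameCoords_lineRoot_zero (hx : hermForm σ (T.map φ) x₀ x₀ = 0) (hyx : hermForm σ (T.map φ) y₀ x₀ = 1)
    (hbx : ∀ j, hermForm σ (T.map φ) (b j) x₀ = 0) (t : R) (v : n → S) :
    Γv (lineRoot σ (T.map φ) x₀ 0 (φ t * δ) *ᵥ v) =
      ((Γv v).1, (Γv v).2 + Sum.elim ![t * (Γv v).1 (Sum.inl 0), -(t * d) * (Γv v).1 (Sum.inl 1)] 0) := by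
  rw [hΓ, hΓ, lineRoot_zero_mulVec]
  dsimp only
  simp only [hermForm_add_right, hermForm_smul_right, hx, hyx, hbx, mul_zero, mul_one, add_zero]
  refine Prod.ext rfl (funext fun i => ?_)
  rcases i with i | j
  · fin_cases i
    · simp only [Fin.zero_eta, Fin.isValue, Pi.add_apply, Sum.elim_inl, Matrix.cons_val_zero, map_add, mul_assoc,
        h.im_map_mul, h.im_mul, h.re_delta, h.im_delta]
      ring
    · simp only [Fin.mk_one, Fin.isValue, Pi.add_apply, Sum.elim_inl, Matrix.cons_val_one, Matrix.cons_val_zero, map_add,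
        mul_assoc, h.re_map_mul, h.re_mul, h.re_delta, h.im_delta]
      ring
  · simp

/-- **the Levi dilations in the chart**: `D(α, β)` (`x₀ ↦ α x₀`, `y₀ ↦ β y₀`) acts on the translation coordinates of the
line by `Res(β) = (re β, d im β; im β, re β)`, on its modulation coordinates by `(re α, -im α; -d im α, re α)`, and fixes
the `Fin m` coordinates. [cite: MoeglinVignerasWaldspurger1987, Chap. 3 §IV.2] -/
theorem frameCoords_lineDilation (hx : hermForm σ (T.map φ) x₀ x₀ = 0) (hy : hermForm σ (T.map φ) y₀ y₀ = 0)
    (hxy : hermForm σ (T.map φ) x₀ y₀ = 1) (hyx : hermForm σ (T.map φ) y₀ x₀ = 1)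
    (hbx : ∀ j, hermForm σ (T.map φ) (b j) x₀ = 0) (hby : ∀ j, hermForm σ (T.map φ) (b j) y₀ = 0) (α β : S)
    (v : n → S) :
    Γv (lineDilation σ (T.map φ) x₀ y₀ α β *ᵥ v) =
      (Sum.elim ![re Ψ β * (Γv v).1 (Sum.inl 0) + d * im Ψ β * (Γv v).1 (Sum.inl 1),
          im Ψ β * (Γv v).1 (Sum.inl 0) + re Ψ β * (Γv v).1 (Sum.inl 1)] (fun j => (Γv v).1 (Sum.inr j)),
        Sum.elim ![re Ψ α * (Γv v).2 (Sum.inl 0) - im Ψ α * (Γv v).2 (Sum.inl 1),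
          -(d * im Ψ α) * (Γv v).2 (Sum.inl 0) + re Ψ α * (Γv v).2 (Sum.inl 1)] (fun j => (Γv v).2 (Sum.inr j))) := by
  rw [hΓ, hΓ, lineDilation_mulVec]
  have e1 : hermForm σ (T.map φ) x₀ (v + ((α - 1) * hermForm σ (T.map φ) y₀ v) • x₀ +
      ((β - 1) * hermForm σ (T.map φ) x₀ v) • y₀) = β * hermForm σ (T.map φ) x₀ v := by
    simp only [hermForm_add_right, hermForm_smul_right, hx, hxy]; ring
  have e2 : hermForm σ (T.map φ) y₀ (v + ((α - 1) * hermForm σ (T.map φ) y₀ v) • x₀ +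
      ((β - 1) * hermForm σ (T.map φ) x₀ v) • y₀) = α * hermForm σ (T.map φ) y₀ v := by
    simp only [hermForm_add_right, hermForm_smul_right, hy, hyx]; ring
  have e3 : ∀ j, hermForm σ (T.map φ) (b j) (v + ((α - 1) * hermForm σ (T.map φ) y₀ v) • x₀ +
      ((β - 1) * hermForm σ (T.map φ) x₀ v) • y₀) = hermForm σ (T.map φ) (b j) v := fun j => by
    simp only [hermForm_add_right, hermForm_smul_right, hbx, hby, mul_zero, add_zero]
  simp only [e1, e2, e3]
  refine Prod.ext (funext fun i => ?_) (funext fun i => ?_)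
  · rcases i with i | j
    · fin_cases i
      · simp only [Fin.zero_eta, Fin.isValue, Sum.elim_inl, Matrix.cons_val_zero, Matrix.cons_val_one, h.re_mul]
        ring
      · simp only [Fin.mk_one, Fin.isValue, Sum.elim_inl, Matrix.cons_val_zero, Matrix.cons_val_one, h.im_mul]
        ring
    · rfl
  · rcases i with i | j
    · fin_cases i
      · simp only [Fin.zero_eta, Fin.isValue, Sum.elim_inl, Matrix.cons_val_zero, Matrix.cons_val_one, h.im_mul]
        ring
      · simp only [Fin.mk_one, Fin.isValue, Sum.elim_inl, Matrix.cons_val_zero, Matrix.cons_val_one, h.re_mul]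
        ring
    · rfl

omit h [DecidableEq n] in
include hΓ in
/-- the `Fin m` coordinates determine `B(bⱼ, v) = Ψ(aⱼ xⱼ, yⱼ)`. [cite: MoeglinVignerasWaldspurger1987, Chap. 3 §IV.2] -/
theorem hermForm_frame_eq_apply (ha : ∀ j, a j ≠ 0) (v : n → S) (j : Fin m) :
    hermForm σ (T.map φ) (b j) v = Ψ (a j * (Γv v).1 (Sum.inr j), (Γv v).2 (Sum.inr j)) := by
  rw [hΓ]
  simp only [Sum.elim_inr, ← mul_assoc, mul_inv_cancel₀ (ha j), one_mul, apply_re_im]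

omit h [DecidableEq n] in
include hΓ in
/-- the line coordinate `λ = Ψ(x₀, x₁) = B(x₀, v)`. [cite: MoeglinVignerasWaldspurger1987, Chap. 3 §IV.2] -/
theorem hermForm_left_eq_apply (v : n → S) :
    hermForm σ (T.map φ) x₀ v = Ψ ((Γv v).1 (Sum.inl 0), (Γv v).1 (Sum.inl 1)) := by
  rw [hΓ]
  simp only [Sum.elim_inl, Matrix.cons_val_zero, Matrix.cons_val_one, apply_re_im]

/-- **the Eichler elements in the chart**: `T_{x₀}(w, τ)` with `w = Σ γⱼ bⱼ` and `τ` real (`σ τ = τ`; an isometry when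
`2 τ = -B(w, w)`) fixes the translation coordinates `(x₀, x₁)` of the line, SHEARS the `Fin m` translation coordinates
`xⱼ ↦ xⱼ + re(λ γⱼ)` (`λ = Ψ(x₀, x₁)`), shifts the `Fin m` modulation coordinates `yⱼ ↦ yⱼ + aⱼ im(λ γⱼ)`, and moves the
modulation coordinates of the line by `(im, -re)` of `τ λ - Σⱼ σ(γⱼ) B(bⱼ, v)`, `B(bⱼ, v) = Ψ(aⱼ xⱼ, yⱼ)`.
[cite: MoeglinVignerasWaldspurger1987, Chap. 3 §IV.2] -/
theorem frameCoords_lineRoot_sum (hx : hermForm σ (T.map φ) x₀ x₀ = 0) (hyx : hermForm σ (T.map φ) y₀ x₀ = 1)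
    (hxb : ∀ j, hermForm σ (T.map φ) x₀ (b j) = 0) (hyb : ∀ j, hermForm σ (T.map φ) y₀ (b j) = 0)
    (hbx : ∀ j, hermForm σ (T.map φ) (b j) x₀ = 0)
    (hbb : ∀ j j', j ≠ j' → hermForm σ (T.map φ) (b j) (b j') = 0) (hba : ∀ j, hermForm σ (T.map φ) (b j) (b j) = φ (a j))
    (ha : ∀ j, a j ≠ 0) (γ : Fin m → S) (τ : S) (v : n → S) :
    Γv (lineRoot σ (T.map φ) x₀ (∑ j, γ j • b j) τ *ᵥ v) =
      (Sum.elim ![(Γv v).1 (Sum.inl 0), (Γv v).1 (Sum.inl 1)]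
          (fun k => (Γv v).1 (Sum.inr k) + re Ψ (Ψ ((Γv v).1 (Sum.inl 0), (Γv v).1 (Sum.inl 1)) * γ k)),
        Sum.elim
          ![(Γv v).2 (Sum.inl 0) + im Ψ (τ * Ψ ((Γv v).1 (Sum.inl 0), (Γv v).1 (Sum.inl 1)) -
              ∑ j, σ (γ j) * Ψ (a j * (Γv v).1 (Sum.inr j), (Γv v).2 (Sum.inr j))),
            (Γv v).2 (Sum.inl 1) - re Ψ (τ * Ψ ((Γv v).1 (Sum.inl 0), (Γv v).1 (Sum.inl 1)) -
              ∑ j, σ (γ j) * Ψ (a j * (Γv v).1 (Sum.inr j), (Γv v).2 (Sum.inr j)))]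
          (fun k => (Γv v).2 (Sum.inr k) + a k * im Ψ (Ψ ((Γv v).1 (Sum.inl 0), (Γv v).1 (Sum.inl 1)) * γ k))) := by
  -- the pairings of the frame with `w = Σ γⱼ bⱼ`
  set w : n → S := ∑ j, γ j • b j with hw
  have hxw : hermForm σ (T.map φ) x₀ w = 0 := by
    rw [hw, hermForm_sum_right]
    exact Finset.sum_eq_zero fun j _ => by rw [hermForm_smul_right, hxb, mul_zero]
  have hyw : hermForm σ (T.map φ) y₀ w = 0 := by
    rw [hw, hermForm_sum_right]
    exact Finset.sum_eq_zero fun j _ => by rw [hermForm_smul_right, hyb, mul_zero]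
  have hbw : ∀ k, hermForm σ (T.map φ) (b k) w = γ k * φ (a k) := by
    intro k
    rw [hw, hermForm_sum_right, Finset.sum_eq_single k]
    · rw [hermForm_smul_right, hba]
    · intro j _ hj; rw [hermForm_smul_right, hbb k j (Ne.symm hj), mul_zero]
    · intro hk; exact absurd (Finset.mem_univ k) hk
  have hwv : hermForm σ (T.map φ) w v = ∑ j, σ (γ j) * hermForm σ (T.map φ) (b j) v := by
    rw [hw, hermForm_sum_left]
    exact Finset.sum_congr rfl fun j _ => by rw [hermForm_smul_left_eq]
  -- `λ` and `B(bⱼ, v)` in coordinates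
  have hlam := hermForm_left_eq_apply Γv hΓ v
  have hbv := fun j => hermForm_frame_eq_apply Γv hΓ ha v j
  -- the pairings of the frame with `T v`
  rw [lineRoot_mulVec]
  set lam := hermForm σ (T.map φ) x₀ v with hlamdef
  have e1 : hermForm σ (T.map φ) x₀ (v + lam • w + (τ * lam - hermForm σ (T.map φ) w v) • x₀) = lam := by
    rw [hermForm_add_right, hermForm_add_right, hermForm_smul_right, hermForm_smul_right, hxw, hx, mul_zero, mul_zero,
      add_zero, add_zero]
  have e2 : hermForm σ (T.map φ) y₀ (v + lam • w + (τ * lam - hermForm σ (T.map φ) w v) • x₀) =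
      hermForm σ (T.map φ) y₀ v + (τ * lam - hermForm σ (T.map φ) w v) := by
    rw [hermForm_add_right, hermForm_add_right, hermForm_smul_right, hermForm_smul_right, hyw, hyx, mul_zero, add_zero,
      mul_one]
  have e3 : ∀ k, hermForm σ (T.map φ) (b k) (v + lam • w + (τ * lam - hermForm σ (T.map φ) w v) • x₀) =
      hermForm σ (T.map φ) (b k) v + lam * γ k * φ (a k) := by
    intro k
    rw [hermForm_add_right, hermForm_add_right, hermForm_smul_right, hermForm_smul_right, hbw, hbx, mul_zero, add_zero,
      mul_assoc]
  conv_lhs => rw [hΓ]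
  simp only [e1, e2, e3]
  rw [hwv]
  simp only [← hbv]
  -- the translation coordinates of the line
  have hx0 : re Ψ lam = (Γv v).1 (Sum.inl 0) := by rw [hlamdef, hΓ]; rfl
  have hx1 : im Ψ lam = (Γv v).1 (Sum.inl 1) := by rw [hlamdef, hΓ]; rfl
  have hy0 : im Ψ (hermForm σ (T.map φ) y₀ v) = (Γv v).2 (Sum.inl 0) := by rw [hΓ]; rfl
  have hy1 : -re Ψ (hermForm σ (T.map φ) y₀ v) = (Γv v).2 (Sum.inl 1) := by rw [hΓ]; rfl
  have hxk : ∀ k, (a k)⁻¹ * re Ψ (hermForm σ (T.map φ) (b k) v) = (Γv v).1 (Sum.inr k) := fun k => by rw [hΓ]; rfl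
  have hyk : ∀ k, im Ψ (hermForm σ (T.map φ) (b k) v) = (Γv v).2 (Sum.inr k) := fun k => by rw [hΓ]; rfl
  have hlam' : lam = Ψ ((Γv v).1 (Sum.inl 0), (Γv v).1 (Sum.inl 1)) := by rw [hlamdef]; exact hlam
  refine Prod.ext (funext fun i => ?_) (funext fun i => ?_)
  · rcases i with i | k
    · fin_cases i
      · simp only [Fin.zero_eta, Fin.isValue, Sum.elim_inl, Matrix.cons_val_zero]
        exact hx0
      · simp only [Fin.mk_one, Fin.isValue, Sum.elim_inl, Matrix.cons_val_one, Matrix.cons_val_zero]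
        exact hx1
    · simp only [Sum.elim_inr]
      rw [map_add, mul_add, mul_comm (lam * γ k) (φ (a k)), h.re_map_mul, ← mul_assoc (a k)⁻¹, inv_mul_cancel₀ (ha k),
        one_mul, hxk, hlam']
  · rcases i with i | k
    · fin_cases i
      · simp only [Fin.zero_eta, Fin.isValue, Sum.elim_inl, Matrix.cons_val_zero, map_add, map_sub, hy0, hlam']
      · simp only [Fin.mk_one, Fin.isValue, Sum.elim_inl, Matrix.cons_val_one, Matrix.cons_val_zero, map_add, map_sub,
          ← hy1, hlam']
        ring
    · simp only [Sum.elim_inr]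
      rw [map_add, mul_comm (lam * γ k) (φ (a k)), h.im_map_mul, hyk, hlam']

end Action

end IsQuadraticCoordinates

end UnitaryGroup

end Literature.NumberTheory.Automorphic
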